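import Mathlib

/-!
# `SeaFactorisationBridge` (crux stmt-QuantumFields-13880) — negative-side support: a WEIGHTED strong
# cluster property with exponent one is ratio mixing, and fails in uniformly mixing channels (finite model)

Wave-4 audit of the r10/r11 typing of hypothesis M1 (`RefSeaTreeMixing`) of the stub `stub_polymerTransfer`
of the line `proper-time-quarantine`.  M1 r10 asks, for every `K'`-separated family of block-local
functionals `|Xᵢ| ≤ 1` and EVERY product size system `ε` (`⟨∏_{i∈J}|Xᵢ|⟩ ≤ ∏_{i∈J} εᵢ` for all `J`),
the weighted split bound `|⟨∏X⟩ − ⟨∏_I X⟩⟨∏_{Iᶜ} X⟩| ≤ C₀^{Σ|Yᵢ|} (∏ εᵢ) e^{−Δ₀ a_k d}` with `C₀, Δ₀` fixed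
before the lattice step `k` (blocks have `(b−1)⁴ → ∞` sites).  Because `ε` is universally quantified, the
consumer may SATURATE it (`ε₀ = ε₁ = ⟨X₀X₁⟩^{1/2}` is admissible for a positively correlated pair), and the
clause then demands `Cov(X₀,X₁) ≤ C₀² ⟨X₀X₁⟩ e^{−Δ₀ d}` — RATIO (ψ-)mixing for arbitrarily rare events.

Definition-free finite model, the *lazy uniform channel* ("with probability `q` the second coordinate
copies the first, uniform on `n` states; otherwise it is resampled"): expectation
`E_{q,n}[F] = q·(1/n)Σᵢ F(i,i) + (1−q)·(1/n²)Σᵢⱼ F(i,j)`, `q = λ^d` at distance `d`.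

* `lazyChannel_cov_eq`, `lazyChannel_decoupling` — `Cov(f(i), g(j)) = q·Cov_unif(f,g)`, hence
  `|Cov| ≤ 2 λ^d` for ALL `n` and all `[−1,1]`-valued `f, g`: the family is uniformly exponentially
  mixing (rate `log(1/λ)`, constant `2`) — the UNWEIGHTED strong cluster property holds uniformly.
* `lazyChannel_rare_pair`, `lazyChannel_productSize`, `lazyChannel_cov_ge_half` — for the rare events
  `{i = 0}`, `{j = 0}`: marginals `1/n`, joint moment `(q(n−1)+1)/n²`, covariance `q(n−1)/n²`; the
  saturating `ε = ⟨X₀X₁⟩^{1/2}` IS a product size system, and `Cov ≥ ⟨X₀X₁⟩/2` as soon as `q(n−1) ≥ 1`.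
* `lazyChannel_no_uniform_weighted_decay` — consequently NO pair `(C, r < 1)` gives the weighted bound
  `Cov ≤ C·(ε₀ε₁)·r^d` uniformly in `n`: the exponent-one weighted form is not a consequence of uniform
  exponential mixing plus product sizes (it is ratio mixing, which a many-state channel violates; the
  boundary data coupling two lattice blocks of side `b → ∞` is such a channel).
* `abs_le_rpow_interpolate`, `weighted_split_bound_of_unweighted` — the positive counterpart the transfer
  actually needs: the UNWEIGHTED bound `|c| ≤ K·e^{−Δ d}` and the product-size bound `|c| ≤ 2P` interpolate
  to `|c| ≤ 2^θ K^{1−θ} P^θ e^{−(1−θ)Δ d}` for every `θ ∈ [0,1]` — weights `(∏ε)^θ` (still multiplicative,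
  still a Kotecký–Preiss small parameter) at the reduced rate `(1−θ)Δ₀`; `split_abs_le_two_prod` is the
  `d = 0` case from the product sizes alone.
-/

namespace Summit.QuantumFields.QCD.Theorems.SeaFactorisationBridge.Negative

open Finset Real

/-! ## The lazy uniform channel -/

/-- **Covariance identity of the lazy uniform channel**: under
`E_{q,n}[F] = q·(1/n)Σᵢ F(i,i) + (1−q)·(1/n²)Σᵢⱼ F(i,j)` (`n ≥ 1`), the covariance of `f(i)` and `g(j)` is
`q` times their covariance under the uniform law on `n` states. [folklore] -/
theorem lazyChannel_cov_eq (n : ℕ) (hn : 0 < n) (q : ℝ) (f g : Fin n → ℝ) :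
    (q * (∑ i, f i * g i) / n + (1 - q) * (∑ i, ∑ j, f i * g j) / n ^ 2) -
        (q * (∑ i, f i) / n + (1 - q) * (∑ i, ∑ _j : Fin n, f i) / n ^ 2) *
          (q * (∑ j, g j) / n + (1 - q) * (∑ _i : Fin n, ∑ j, g j) / n ^ 2) =
      q * ((∑ i, f i * g i) / n - (∑ i, f i) / n * ((∑ j, g j) / n)) := by
  have hn' : (n : ℝ) ≠ 0 := by exact_mod_cast hn.ne'
  have h1 : (∑ i, ∑ j, f i * g j) = (∑ i, f i) * ∑ j, g j := by
    rw [Finset.sum_mul_sum]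
  have h2 : (∑ i, ∑ _j : Fin n, f i) = n * ∑ i, f i := by
    simp [Finset.sum_const, Finset.card_univ, Fintype.card_fin, Finset.mul_sum]
  have h3 : (∑ _i : Fin n, ∑ j, g j) = n * ∑ j, g j := by
    simp [Finset.sum_const, Finset.card_univ, Fintype.card_fin]
  rw [h1, h2, h3]
  field_simp
  ring

/-- **Uniform exponential decoupling of the lazy channel**: for `[−1,1]`-valued `f, g` and `q ≥ 0` the
covariance is at most `2q` — with `q = λ^d` this is the unweighted strong cluster property at rate
`log(1/λ)` with constant `2`, for EVERY number of states `n`. [folklore] -/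
theorem lazyChannel_decoupling (n : ℕ) (hn : 0 < n) (q : ℝ) (hq : 0 ≤ q) (f g : Fin n → ℝ)
    (hf : ∀ i, |f i| ≤ 1) (hg : ∀ j, |g j| ≤ 1) :
    |(q * (∑ i, f i * g i) / n + (1 - q) * (∑ i, ∑ j, f i * g j) / n ^ 2) -
        (q * (∑ i, f i) / n + (1 - q) * (∑ i, ∑ _j : Fin n, f i) / n ^ 2) *
          (q * (∑ j, g j) / n + (1 - q) * (∑ _i : Fin n, ∑ j, g j) / n ^ 2)| ≤ 2 * q := by
  rw [lazyChannel_cov_eq n hn q f g, abs_mul, abs_of_nonneg hq, mul_comm]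
  refine mul_le_mul_of_nonneg_right ?_ hq
  have hnpos : (0 : ℝ) < n := by exact_mod_cast hn
  -- uniform averages of `[−1,1]`-valued functions lie in `[−1,1]`
  have havg : ∀ h : Fin n → ℝ, (∀ i, |h i| ≤ 1) → |(∑ i, h i) / n| ≤ 1 := by
    intro h hh
    rw [abs_div, abs_of_pos hnpos, div_le_one hnpos]
    calc |∑ i, h i| ≤ ∑ i, |h i| := Finset.abs_sum_le_sum_abs _ _
      _ ≤ ∑ _i : Fin n, (1 : ℝ) := Finset.sum_le_sum fun i _ => hh i
      _ = n := by simp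
  have hfg : |(∑ i, f i * g i) / n| ≤ 1 := by
    refine havg (fun i => f i * g i) fun i => ?_
    rw [abs_mul]
    exact mul_le_one₀ (hf i) (abs_nonneg _) (hg i)
  have hf' := havg f hf
  have hg' := havg g hg
  calc |(∑ i, f i * g i) / n - (∑ i, f i) / n * ((∑ j, g j) / n)|
      ≤ |(∑ i, f i * g i) / n| + |(∑ i, f i) / n * ((∑ j, g j) / n)| := abs_sub _ _
    _ ≤ 1 + 1 := by
        refine add_le_add hfg ?_
        rw [abs_mul]
        exact mul_le_one₀ hf' (abs_nonneg _) hg'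
    _ = 2 := by norm_num

/-- **The rare pair of the lazy channel**: for the indicators `X₀ = 1{i = 0}`, `X₁ = 1{j = 0}` the
marginals are `1/n`, the joint moment is `(q(n−1)+1)/n²` and the covariance is `q(n−1)/n²`. [folklore] -/
theorem lazyChannel_rare_pair (n : ℕ) (hn : 0 < n) (q : ℝ) :
    let f : Fin n → ℝ := fun i => if i = ⟨0, hn⟩ then 1 else 0
    (q * (∑ i, f i) / n + (1 - q) * (∑ i, ∑ _j : Fin n, f i) / n ^ 2 = 1 / n) ∧
    (q * (∑ i, f i * f i) / n + (1 - q) * (∑ i, ∑ j, f i * f j) / n ^ 2 = (q * (n - 1) + 1) / n ^ 2) ∧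
    ((q * (∑ i, f i * f i) / n + (1 - q) * (∑ i, ∑ j, f i * f j) / n ^ 2) -
        (q * (∑ i, f i) / n + (1 - q) * (∑ i, ∑ _j : Fin n, f i) / n ^ 2) *
          (q * (∑ j, f j) / n + (1 - q) * (∑ _i : Fin n, ∑ j, f j) / n ^ 2) =
      q * (n - 1) / n ^ 2) := by
  intro f
  have hn' : (n : ℝ) ≠ 0 := by exact_mod_cast hn.ne'
  have hs : (∑ i, f i) = 1 := by simp [f, Finset.sum_ite_eq']
  have hs2 : (∑ i, f i * f i) = 1 := by simp [f, Finset.sum_ite_eq']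
  have hss : (∑ i, ∑ j, f i * f j) = 1 := by
    rw [← Finset.sum_mul_sum, hs, mul_one]
  have h2 : (∑ i, ∑ _j : Fin n, f i) = n := by
    simp [Finset.sum_const, Finset.card_univ, Fintype.card_fin, hs, ← Finset.mul_sum]
  have h3 : (∑ _i : Fin n, ∑ j, f j) = n := by
    simp [Finset.sum_const, Finset.card_univ, Fintype.card_fin, hs]
  refine ⟨?_, ?_, ?_⟩
  · rw [hs, h2]; field_simp; ring
  · rw [hs2, hss]; field_simp; ring
  · rw [hss, h2, h3, hs2, hs]; field_simp; ring

/-- **The saturating size system is a product size system**: with `ε := ⟨X₀X₁⟩^{1/2}` one has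
`⟨X₀⟩ = ⟨X₁⟩ = 1/n ≤ ε` and `⟨X₀X₁⟩ = ε·ε` (`0 ≤ q`, `n ≥ 1`), i.e. `(ε, ε)` satisfies every clause of the
r10 product-size hypothesis for the pair. [folklore] -/
theorem lazyChannel_productSize (n : ℕ) (hn : 0 < n) (q : ℝ) (hq : 0 ≤ q) :
    (1 : ℝ) / n ≤ Real.sqrt ((q * (n - 1) + 1) / n ^ 2) ∧
      (q * (n - 1) + 1) / n ^ 2 = Real.sqrt ((q * (n - 1) + 1) / n ^ 2) * Real.sqrt ((q * (n - 1) + 1) / n ^ 2) := by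
  have hnpos : (0 : ℝ) < n := by exact_mod_cast hn
  have hn1 : (0 : ℝ) ≤ n - 1 := by
    have : (1 : ℝ) ≤ n := by exact_mod_cast hn
    linarith
  have hnum : 0 ≤ q * (n - 1) + 1 := by positivity
  refine ⟨?_, (Real.mul_self_sqrt (div_nonneg hnum (by positivity))).symm⟩
  refine Real.le_sqrt_of_sq_le ?_
  rw [div_pow, one_pow, div_le_div_iff_of_pos_right (by positivity)]
  nlinarith

/-- **Saturation**: once `q(n−1) ≥ 1` the covariance of the rare pair is at least HALF its joint moment,
`(q(n−1)+1)/(2n²) ≤ q(n−1)/n²`. [folklore] -/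
theorem lazyChannel_cov_ge_half (n : ℕ) (hn : 0 < n) (q : ℝ) (hqn : 1 ≤ q * (n - 1)) :
    (q * (n - 1) + 1) / n ^ 2 / 2 ≤ q * (n - 1) / n ^ 2 := by
  have hnpos : (0 : ℝ) < n := by exact_mod_cast hn
  rw [div_div, div_le_div_iff₀ (by positivity) (by positivity)]
  nlinarith [sq_nonneg (n : ℝ)]

/-- **No uniform exponent-one weighted decay** (the finite-model obstruction to M1 r10): for every
`λ > 0` (think `λ ∈ (0,1]`) there is NO pair `(C, r)` with `r < 1` such that, for all numbers of states `n ≥ 1` and all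
distances `d` (`q = λ^d`), the rare pair obeys the weighted split bound
`Cov(X₀,X₁) ≤ C · (ε₀ε₁) · r^d` with the admissible saturating sizes `ε₀ε₁ = ⟨X₀X₁⟩ = (λ^d(n−1)+1)/n²` —
although (`lazyChannel_decoupling`) every member of the family decouples all `[−1,1]`-valued functionals at
the uniform exponential rate `|Cov| ≤ 2λ^d`.  Witness: `d` with `C r^d < 1/2`, then `n − 1 ≥ λ^{−d}`.
[folklore] -/
theorem lazyChannel_no_uniform_weighted_decay (lam : ℝ) (hlam : 0 < lam) (C r : ℝ) (hr1 : r < 1) :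
    ∃ (n : ℕ) (d : ℕ), 0 < n ∧ 1 ≤ lam ^ d * (n - 1) ∧
      C * ((lam ^ d * (n - 1) + 1) / n ^ 2) * r ^ d < lam ^ d * (n - 1) / n ^ 2 := by
  -- a distance at which the claimed decay factor is below one half
  obtain ⟨d, hd⟩ : ∃ d : ℕ, C * r ^ d < 1 / 2 := by
    rcases le_or_gt C 0 with hC | hC
    · exact ⟨0, by simp; linarith⟩
    · obtain ⟨d, hd⟩ := exists_pow_lt_of_lt_one (show (0 : ℝ) < 1 / (2 * C) by positivity) hr1
      refine ⟨d, ?_⟩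
      calc C * r ^ d < C * (1 / (2 * C)) := mul_lt_mul_of_pos_left hd hC
        _ = 1 / 2 := by field_simp
  -- enough states that the channel copy dominates the joint moment of the rare pair
  set n : ℕ := ⌈1 / lam ^ d⌉₊ + 2 with hn
  have hqpos : 0 < lam ^ d := pow_pos hlam d
  have hnpos : 0 < n := by omega
  have hn1 : (1 : ℝ) ≤ lam ^ d * (n - 1) := by
    have hceil : 1 / lam ^ d ≤ (⌈1 / lam ^ d⌉₊ : ℝ) := Nat.le_ceil _
    have hcast : ((n : ℕ) : ℝ) - 1 = (⌈1 / lam ^ d⌉₊ : ℝ) + 1 := by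
      rw [hn]; push_cast; ring
    rw [hcast]
    calc (1 : ℝ) = lam ^ d * (1 / lam ^ d) := by field_simp
      _ ≤ lam ^ d * ((⌈1 / lam ^ d⌉₊ : ℝ) + 1) := by
          refine mul_le_mul_of_nonneg_left ?_ hqpos.le
          linarith
  refine ⟨n, d, hnpos, hn1, ?_⟩
  have hnR : (0 : ℝ) < n := by exact_mod_cast hnpos
  have hmom : 0 < (lam ^ d * (n - 1) + 1) / (n : ℝ) ^ 2 := by
    have : 0 ≤ lam ^ d * ((n : ℝ) - 1) := le_trans zero_le_one hn1
    positivity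
  have hhalf := lazyChannel_cov_ge_half n hnpos (lam ^ d) hn1
  calc C * ((lam ^ d * (n - 1) + 1) / n ^ 2) * r ^ d
      = (C * r ^ d) * ((lam ^ d * (n - 1) + 1) / n ^ 2) := by ring
    _ < (1 / 2) * ((lam ^ d * (n - 1) + 1) / n ^ 2) := mul_lt_mul_of_pos_right hd hmom
    _ = (lam ^ d * (n - 1) + 1) / n ^ 2 / 2 := by ring
    _ ≤ lam ^ d * (n - 1) / n ^ 2 := hhalf

/-! ## The positive counterpart: interpolating the unweighted bound with the product sizes -/

/-- **Interpolation**: `|c| ≤ a` and `|c| ≤ b` (`a ≥ 0`) give `|c| ≤ a^{1−θ} b^θ` for every `θ ∈ [0,1]`.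
[folklore] -/
theorem abs_le_rpow_interpolate {a b c θ : ℝ} (ha : 0 ≤ a) (hca : |c| ≤ a) (hcb : |c| ≤ b)
    (hθ : 0 ≤ θ) (hθ1 : θ ≤ 1) : |c| ≤ a ^ (1 - θ) * b ^ θ := by
  have hc : 0 ≤ |c| := abs_nonneg c
  have hsplit : |c| = |c| ^ (1 - θ) * |c| ^ θ := by
    rw [← Real.rpow_add' hc (by norm_num : (1 - θ) + θ ≠ 0)]
    norm_num
  rw [hsplit]
  exact mul_le_mul (Real.rpow_le_rpow hc hca (by linarith)) (Real.rpow_le_rpow hc hcb hθ)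
    (Real.rpow_nonneg hc _) (Real.rpow_nonneg ha _)

/-- **The `d = 0` case is the product-size hypothesis**: if `|x| ≤ P` (`= ∏ε`), `|y| ≤ P₁` (`= ∏_I ε`),
`|z| ≤ P₂` (`= ∏_{Iᶜ} ε`) and `P₁P₂ ≤ P`, then `|x − y z| ≤ 2P`. [folklore] -/
theorem split_abs_le_two_prod {x y z P P₁ P₂ : ℝ} (hx : |x| ≤ P) (hy : |y| ≤ P₁) (hz : |z| ≤ P₂)
    (hP : P₁ * P₂ ≤ P) : |x - y * z| ≤ 2 * P := by
  have hyz : |y * z| ≤ P := by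
    rw [abs_mul]
    exact (mul_le_mul hy hz (abs_nonneg _) ((abs_nonneg _).trans hy)).trans hP
  calc |x - y * z| ≤ |x| + |y * z| := abs_sub _ _
    _ ≤ P + P := add_le_add hx hyz
    _ = 2 * P := by ring

/-- **Weighted split bound from the unweighted one** (what the Kotecký–Preiss transfer consumes): an
unweighted strong-cluster bound `|c| ≤ K e^{−Δ δ}` (`K = C₀^{Σ|Yᵢ|}`) together with the product-size bound
`|c| ≤ 2P` (`P = ∏ εᵢ`, `split_abs_le_two_prod`) yields, for every `θ ∈ [0,1]`,
`|c| ≤ 2^θ K^{1−θ} P^θ e^{−(1−θ)Δ δ}`: the weights `(∏εᵢ)^θ = ∏ εᵢ^θ` ride along multiplicatively at the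
reduced rate `(1−θ)Δ`.  (Exponent `θ = 1` is NOT available: `lazyChannel_no_uniform_weighted_decay`.)
[folklore] -/
theorem weighted_split_bound_of_unweighted {c K P Δ δ θ : ℝ} (hK : 0 ≤ K) (hP : 0 ≤ P)
    (hcK : |c| ≤ K * Real.exp (-(Δ * δ))) (hcP : |c| ≤ 2 * P) (hθ : 0 ≤ θ) (hθ1 : θ ≤ 1) :
    |c| ≤ 2 ^ θ * K ^ (1 - θ) * P ^ θ * Real.exp (-((1 - θ) * Δ * δ)) := by
  have hexp : 0 ≤ Real.exp (-(Δ * δ)) := (Real.exp_pos _).le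
  have h := abs_le_rpow_interpolate (mul_nonneg hK hexp) hcK hcP hθ hθ1
  rw [Real.mul_rpow hK hexp, Real.mul_rpow (by norm_num : (0 : ℝ) ≤ 2) hP, ← Real.exp_mul] at h
  calc |c| ≤ K ^ (1 - θ) * Real.exp (-(Δ * δ) * (1 - θ)) * (2 ^ θ * P ^ θ) := h
    _ = 2 ^ θ * K ^ (1 - θ) * P ^ θ * Real.exp (-((1 - θ) * Δ * δ)) := by ring_nf

end Summit.QuantumFields.QCD.Theorems.SeaFactorisationBridge.Negative
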